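import Mathlib
import Summits.MatrixMultiplication.Statement
import Literature.RingTheory.KrullDimension.HomogeneousCommonZero
import Summits.MatrixMultiplication.MatrixMultiplication.Theorems.GraphEquationsTestCount

/-!
# GraphEquations — kernel dimension is paid for in quadratic tests (M50; cell `decomp-mm`, lens-5 g40)

Helper kernel beneath the attacked crux `MultiplicityReduction` (stmt-MatrixMultiplication-27806) of
route `GraphEquations`, rung `3` in affine form (`AffSystem`, M40).  The POINTWISE refinement of the
degree-free count of M48 (`AffSystem.Correct.sq_le_m`):

* `AffSystem.Correct.le_card_of_linearIndependent` — if `S` is correct and `v₁, …, v_k` are linearly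
  independent KERNEL vectors at a graph point `(A,B)` (`J_g(A,B) · v_i = 0` for all `g`), then every
  set `T` of tests outside which the quadratic parts `q_g` vanish on `span(v)` has `|T| ≥ k`;
* `AffSystem.Correct.finrank_kerSpace_le` — hence **`dim K(A,B) ≤ #{g : M_g ≠ 0}`** at every graph
  point: rank deficiency of the Jacobian must be paid for by as many tests with a non-zero quadratic
  part (`quadSupport`); with no quadratic tests the system is reduced everywhere, with one it has
  corank `≤ 1` everywhere, etc.;
* `AffSystem.Correct.sq_le_card_quadSupport_of_kappa_zero` — a correct affine system with `κ = 0`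
  (all gradients vanish at the graph point `0`) has **at least `n²` tests with `M_g ≠ 0`**.

Proof: on `K = span(v)` the tests restricted to the fibre `{(A, B, AB + δ)}` lose their linear part
and become the quadratic forms `q_g|_K`, i.e. `< k` polynomials without constant term in the `k`
coordinates of `K` (`AffTest.quadRestrict`); the affine dimension theorem at the origin
(`Literature.RingTheory.KrullDimension.exists_ne_zero_common_zero_of_card_lt`) gives a common zero
`x ≠ 0`, so `δ = Σ xᵢ vᵢ ≠ 0` is an isotropic kernel vector and `(A, B, AB + δ)` a spurious zero
(`AffSystem.Correct.eq_zero_of_isKer_of_quad`, M40).  A constraint on counterexamples to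
`AffineQuadricRigidity n`: wherever the rank of `J` drops by `k`, at least `k` quadratic tests are
alive on the kernel.  Sorry-free; no stub credit claimed.
-/

set_option linter.dupNamespace false
set_option linter.unusedSectionVars false

noncomputable section

namespace Summit.MatrixMultiplication.MatrixMultiplication.Theorems.GraphEquations

open MvPolynomial Matrix Literature.Computability.AlgebraicComplexity

open scoped Classical

variable {n : ℕ}

/-- The linear combination `Σ xᵢ vᵢ` of a family of fibre vectors. -/
def comb {k : ℕ} (v : Fin k → Vec n) (x : Fin k → ℂ) : Vec n := ∑ i, x i • v i

/-- `comb v 0 = 0`. -/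
@[simp] theorem comb_zero {k : ℕ} (v : Fin k → Vec n) : comb v 0 = 0 := by
  simp [comb]

/-- Coordinates of a combination. -/
theorem comb_apply {k : ℕ} (v : Fin k → Vec n) (x : Fin k → ℂ) (q : Fin n × Fin n) :
    comb v x q = ∑ i, x i * v i q := by
  simp [comb, Finset.sum_apply]

namespace AffTest

variable (g : AffTest n)

/-- The quadratic part `q_g(δ) = ⟨M δ, δ⟩` as a polynomial in the `N` fibre coordinates. -/
def quadPoly : MvPolynomial (Fin n × Fin n) ℂ := ∑ q, ∑ q', C (g.M q q') * X q' * X q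

/-- `quadPoly` evaluates to `quad`. -/
theorem eval_quadPoly (δ : Vec n) : MvPolynomial.eval δ g.quadPoly = g.quad δ := by
  simp [quadPoly, quad, dotProduct, Matrix.mulVec, Finset.sum_mul, map_sum]

/-- The quadratic part restricted to `span(v₁, …, v_k)`, in the coordinates `x`. -/
def quadRestrict {k : ℕ} (v : Fin k → Vec n) : MvPolynomial (Fin k) ℂ :=
  bind₁ (fun q : Fin n × Fin n => ∑ i : Fin k, C (v i q) * X i) g.quadPoly

/-- `quadRestrict` evaluates to `quad` of the combination. -/
theorem eval_quadRestrict {k : ℕ} (v : Fin k → Vec n) (x : Fin k → ℂ) :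
    MvPolynomial.eval x (g.quadRestrict v) = g.quad (comb v x) := by
  have hg : (fun q => eval₂Hom (RingHom.id ℂ) x (∑ i : Fin k, C (v i q) * X i)) = comb v x := by
    funext q
    rw [comb_apply, map_sum]
    exact Finset.sum_congr rfl fun i _ => by simp [mul_comm]
  show eval₂Hom (RingHom.id ℂ) x (bind₁ _ g.quadPoly) = _
  rw [eval₂Hom_bind₁, hg]
  exact g.eval_quadPoly (comb v x)

/-- `quadRestrict` has no constant term. -/
theorem constantCoeff_quadRestrict {k : ℕ} (v : Fin k → Vec n) :
    constantCoeff (g.quadRestrict v) = 0 := by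
  rw [← MvPolynomial.eval_zero, eval_quadRestrict, comb_zero]
  simp [quad]

end AffTest

namespace AffSystem

variable {S : AffSystem n}

/-- The kernel `K(A,B) = {δ : J_g(A,B) · δ = 0 ∀ g}` as a subspace of the fibre. -/
def kerSpace (S : AffSystem n) (A B : Vec n) : Submodule ℂ (Vec n) where
  carrier := {δ | S.IsKer A B δ}
  add_mem' := by
    intro a b ha hb i
    rw [dotProduct_add, ha i, hb i, add_zero]
  zero_mem' := fun i => dotProduct_zero _
  smul_mem' := by
    intro c a ha i
    rw [dotProduct_smul, ha i, smul_zero]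

/-- Membership in `kerSpace`. -/
theorem mem_kerSpace {A B δ : Vec n} : δ ∈ S.kerSpace A B ↔ S.IsKer A B δ := Iff.rfl

/-- Reduced at `(A,B)` iff the kernel space is trivial. -/
theorem reducedAt_iff_kerSpace_eq_bot {A B : Vec n} : S.ReducedAt A B ↔ S.kerSpace A B = ⊥ := by
  rw [Submodule.eq_bot_iff]
  rfl

/-- A combination of kernel vectors is a kernel vector. -/
theorem isKer_comb {A B : Vec n} {k : ℕ} {v : Fin k → Vec n} (hK : ∀ i, S.IsKer A B (v i))
    (x : Fin k → ℂ) : S.IsKer A B (comb v x) := by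
  intro o
  rw [comb, dotProduct_sum]
  exact Finset.sum_eq_zero fun i _ => by rw [dotProduct_smul, hK i o, smul_zero]

/-- The QUADRATIC SUPPORT: tests with a non-zero quadratic part `M_g`. -/
def quadSupport (S : AffSystem n) : Finset (Fin S.m) := Finset.univ.filter fun o => (S.test o).M ≠ 0

/-- Outside the quadratic support `quad` vanishes identically. -/
theorem quad_eq_zero_of_not_mem_quadSupport {o : Fin S.m} (ho : o ∉ S.quadSupport) (δ : Vec n) :
    (S.test o).quad δ = 0 := by
  have hM : (S.test o).M = 0 := by simpa [quadSupport] using ho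
  simp [AffTest.quad, hM]

/-- **Kernel dimension is paid for in quadratic tests.**  For a correct system, `k` linearly
independent kernel vectors at `(A,B)` force `|T| ≥ k` for every set `T` of tests outside which the
quadratic parts vanish on their span. -/
theorem Correct.le_card_of_linearIndependent (hC : S.Correct) {A B : Vec n} {k : ℕ}
    {v : Fin k → Vec n} (hv : LinearIndependent ℂ v) (hK : ∀ i, S.IsKer A B (v i))
    (T : Finset (Fin S.m)) (hT : ∀ o, o ∉ T → ∀ x : Fin k → ℂ, (S.test o).quad (comb v x) = 0) :
    k ≤ T.card := by
  by_contra hlt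
  push Not at hlt
  set s := T.image fun o => (S.test o).quadRestrict v with hs_def
  have hs : s.card < k := Finset.card_image_le.trans_lt hlt
  have h0 : ∀ p ∈ s, constantCoeff p = 0 := by
    intro p hp
    obtain ⟨o, -, rfl⟩ := Finset.mem_image.mp hp
    exact (S.test o).constantCoeff_quadRestrict v
  obtain ⟨x, hx0, hx⟩ :=
    Literature.RingTheory.KrullDimension.exists_ne_zero_common_zero_of_card_lt s h0 hs
  have hq : ∀ o, (S.test o).quad (comb v x) = 0 := fun o => by
    by_cases ho : o ∈ T
    · rw [← AffTest.eval_quadRestrict]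
      exact hx _ (Finset.mem_image_of_mem _ ho)
    · exact hT o ho x
  have hzero : comb v x = 0 := hC.eq_zero_of_isKer_of_quad (isKer_comb hK x) hq
  exact hx0 (funext fun i => Fintype.linearIndependent_iff.mp hv x hzero i)

/-- **`k ≤ #quadSupport`** for `k` independent kernel vectors of a correct system. -/
theorem Correct.le_card_quadSupport (hC : S.Correct) {A B : Vec n} {k : ℕ} {v : Fin k → Vec n}
    (hv : LinearIndependent ℂ v) (hK : ∀ i, S.IsKer A B (v i)) : k ≤ S.quadSupport.card :=
  hC.le_card_of_linearIndependent hv hK _ fun _ ho _ => quad_eq_zero_of_not_mem_quadSupport ho _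

/-- **`dim K(A,B) ≤ #{g : M_g ≠ 0}` at every graph point of a correct affine system.** -/
theorem Correct.finrank_kerSpace_le (hC : S.Correct) (A B : Vec n) :
    Module.finrank ℂ (S.kerSpace A B) ≤ S.quadSupport.card := by
  set W := S.kerSpace A B
  let b := Module.finBasis ℂ W
  have hv : LinearIndependent ℂ (W.subtype ∘ b) :=
    b.linearIndependent.map' W.subtype (Submodule.ker_subtype W)
  exact hC.le_card_quadSupport hv fun i => (b i).2

/-- In particular a correct system WITHOUT quadratic tests is reduced everywhere. -/
theorem Correct.reducedAt_of_quadSupport_eq_empty (hC : S.Correct) (h : S.quadSupport = ∅)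
    (A B : Vec n) : S.ReducedAt A B := by
  rw [reducedAt_iff_kerSpace_eq_bot, ← Submodule.finrank_eq_zero]
  have := hC.finrank_kerSpace_le A B
  rw [h, Finset.card_empty] at this
  omega

/-- With `κ = 0` every fibre vector is a kernel vector at the graph point `0`. -/
theorem isKer_zero_of_kappa_zero (hκ : ∀ o, (S.test o).κ = 0) (δ : Vec n) : S.IsKer 0 0 δ := by
  intro o
  have hj : (S.test o).jac 0 0 = 0 := by
    simp [AffTest.jac_eq, hκ o, prodVec_zero_left]
  rw [hj, zero_dotProduct]

/-- **A correct affine system with `κ = 0` has at least `n²` tests with `M_g ≠ 0`.** -/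
theorem Correct.sq_le_card_quadSupport_of_kappa_zero (hC : S.Correct) (hκ : ∀ o, (S.test o).κ = 0) :
    n * n ≤ S.quadSupport.card := by
  have hv : LinearIndependent ℂ (⇑(Pi.basisFun ℂ (Fin n × Fin n)) ∘ ⇑(flat n).symm) :=
    (Pi.basisFun ℂ (Fin n × Fin n)).linearIndependent.comp _ (flat n).symm.injective
  exact hC.le_card_quadSupport hv fun _ => isKer_zero_of_kappa_zero hκ _

end AffSystem

end Summit.MatrixMultiplication.MatrixMultiplication.Theorems.GraphEquations

end
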